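import Summits.Ventures.HSemireg.WedgeHankelRecurrenceGaussChebyshevUDvdIff

/-!
# Venture HSemireg — **THE IDEAL `(U_{m−1}, U_{n−1}) = (U_{gcd(m,n)−1})` IN `R[X]` FOR EVERY COMMUTATIVE RING `R`**: Mathlib's second-kind Chebyshev polynomials form a STRONG DIVISIBILITY
# SEQUENCE in the sharp (Bézout) sense — the Euclidean step `(U_{j+m}, U_{m−1}) = (U_j, U_{m−1})` from the addition formula and the Cassini coprimality of consecutive `U`'s, iterated along
# `Nat.gcd`; consequences: a Bézout representation of `U_{gcd−1}`, the gcd universal property, **`gcd(m,n) = 1 ⇒ U_{m−1}, U_{n−1}` coprime over ANY commutative ring** (over `ℤ` included), and the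
# iff over every domain with `2 ≠ 0` (the node-set reading: the common zeros of `U_{m−1}`, `U_{n−1}` are exactly the zeros of `U_{gcd(m,n)−1}`, i.e. the second-kind Gauss–Chebyshev ∕ Fejér nodes
# shared by the `m`- and `n`-point rules are the nodes of the `gcd(m,n)`-point rule)

HONEST FRAMING. Part of the Lean index of the computation cell `pub-hsemireg` (seat p10 gen 48, Sunday typer «UNIFORM-IN-n»).  Polynomial ∕ ideal algebra only; no variety, no cohomology theory,
no sheaf, no Ext group and no semiregularity map is constructed here; nothing here says that HC / HC_CM / HC_AV holds; no Literature fact (unproved `Prop`) is declared or used.  Custodian versions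
as in `WedgeHankelSiegelIdeal` (1/3).
SOURCES (cited).  M. O. Rayes, V. Trevisan, P. S. Wang, *Factorization properties of Chebyshev polynomials*, Comput. Math. Appl. 50 (2005) 1231–1240, Thm 5 (`gcd(U_m, U_n) = U_{gcd(m+1,n+1)−1}`);
J. C. Mason, D. C. Handscomb, *Chebyshev Polynomials* (2003), §1.2 ∕ Ch. 5 (addition formula); the strong-divisibility mechanism is that of Lucas sequences (P. Ribenboim, *My Numbers, My Friends*
(2000), Ch. 1 §2 (IV.9)).  Typed here for IDEALS of `R[X]`, `R` any commutative ring (sharper than a gcd statement over a field).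
PROOF TYPED HERE.  N453 `chebyshevU_add`; N445 `chebyshev_isCoprime_U_succ`; Mathlib `Ideal.span_pair_add_mul_right`, `Ideal.span_pair_comm ∕ _zero`, `Ideal.mem_span_pair`, `Ideal.mem_span_singleton`,
`Nat.gcd.induction`, `Nat.gcd_rec`, `Polynomial.natDegree_eq_zero_of_isUnit`, `natDegree_U_natCast`.
DEDUP DISCLOSURE (`rg -n 'span_pair_mul_right_of_isCoprime|chebyshevU_span_pair|chebyshevU_bezout_gcd|dvd_chebyshevU_gcd|chebyshevU_gcd_pred_dvd|isCoprime_pred_of_coprime|of_isDomain' Summits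
Literature HarnessLib`, 2026-09-04): 0 hits; N453 `chebyshevU_isCoprime_pred_iff_coprime` is the FIELD iff (here: any domain with `2 ≠ 0`, and the `⇐` half over any commutative ring); N438 ∕ N456 are
divisibility statements, not the ideal.

WHAT IS IN THE TREE.  N438, N445, N453, N454, N456.
THIS FILE (namespace `Summit.Ventures.HSemireg.Wedge.HankelOuter` continued; CHAINED on N456; 0 definitions):
* §1222 `span_pair_mul_right_of_isCoprime` (ideal bookkeeping), `chebyshevU_span_pair_add`, `chebyshevU_span_pair_add_mul`, **`chebyshevU_span_pair_eq_span_gcd`** (`(U_{m−1},U_{n−1}) =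
  (U_{gcd(m,n)−1})`), `chebyshevU_span_pair_eq_span_gcd_succ`, `chebyshevU_bezout_gcd`, `dvd_chebyshevU_gcd`, `chebyshevU_gcd_pred_dvd_left ∕ _right`, **`chebyshevU_isCoprime_pred_of_coprime`**,
  `chebyshevU_isCoprime_of_coprime_succ`, **`chebyshevU_isCoprime_pred_iff_coprime_of_isDomain`**, `chebyshevU_isCoprime_iff_coprime_succ_of_isDomain`.
CAVEATS.  The iff needs a domain with `2 ≠ 0` (over `ZMod 2`, `U_1 = 2X = 0`).  Nothing Ext-side.  New names only.
-/

open Module Polynomial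
open scoped Matrix Polynomial

namespace Summit.Ventures.HSemireg.Wedge.HankelOuter

/-! ## §1222. The ideal `(U_{m−1}, U_{n−1}) = (U_{gcd(m,n)−1})` -/

/-- Ideal bookkeeping: `(x·u, y) = (x, y)` when `u` and `y` are coprime (any commutative ring). [this file, §1222] -/
theorem span_pair_mul_right_of_isCoprime {A : Type*} [CommRing A] {u y : A} (h : IsCoprime u y) (x : A) :
    Ideal.span {x * u, y} = Ideal.span {x, y} := by
  apply le_antisymm
  · rw [Ideal.span_le, Set.insert_subset_iff, Set.singleton_subset_iff]
    exact ⟨Ideal.mem_span_pair.2 ⟨u, 0, by ring⟩, Ideal.mem_span_pair.2 ⟨0, 1, by ring⟩⟩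
  · rw [Ideal.span_le, Set.insert_subset_iff, Set.singleton_subset_iff]
    obtain ⟨a, b, hab⟩ := h
    exact ⟨Ideal.mem_span_pair.2 ⟨a, x * b, by linear_combination x * hab⟩, Ideal.mem_span_pair.2 ⟨0, 1, by ring⟩⟩

/-- **Euclidean step for ideals: `(U_{j+m}, U_{m−1}) = (U_j, U_{m−1})`** (all `j, m ∈ ℤ`, any commutative ring). [addition formula + Cassini coprimality; this file, §1222] -/
theorem chebyshevU_span_pair_add {R : Type*} [CommRing R] (j m : ℤ) :
    Ideal.span {Polynomial.Chebyshev.U R (j + m), Polynomial.Chebyshev.U R (m - 1)} =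
      Ideal.span {Polynomial.Chebyshev.U R j, Polynomial.Chebyshev.U R (m - 1)} := by
  have hadd : Polynomial.Chebyshev.U R (j + m) =
      Polynomial.Chebyshev.U R j * Polynomial.Chebyshev.U R m + (-Polynomial.Chebyshev.U R (j - 1)) * Polynomial.Chebyshev.U R (m - 1) := by
    rw [chebyshevU_add]; ring
  have hsucc : IsCoprime (Polynomial.Chebyshev.U R m) (Polynomial.Chebyshev.U R (m - 1)) := by
    have h := chebyshev_isCoprime_U_succ (R := R) (m - 1)
    rwa [sub_add_cancel] at h
  rw [hadd, Ideal.span_pair_add_mul_right, span_pair_mul_right_of_isCoprime hsucc]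

/-- Iterated: `(U_{j+km}, U_{m−1}) = (U_j, U_{m−1})` (`k ∈ ℕ`). [this file, §1222] -/
theorem chebyshevU_span_pair_add_mul {R : Type*} [CommRing R] (j m : ℤ) (k : ℕ) :
    Ideal.span {Polynomial.Chebyshev.U R (j + k * m), Polynomial.Chebyshev.U R (m - 1)} =
      Ideal.span {Polynomial.Chebyshev.U R j, Polynomial.Chebyshev.U R (m - 1)} := by
  induction k with
  | zero => rw [Nat.cast_zero, zero_mul, add_zero]
  | succ k ih => rw [Nat.cast_succ, add_one_mul, ← add_assoc, chebyshevU_span_pair_add, ih]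

/-- **`(U_{m−1}, U_{n−1}) = (U_{gcd(m,n)−1})` as ideals of `R[X]`, for all `m, n ∈ ℕ` and every commutative ring `R`** (with `U_{−1} = 0`). [Rayes–Trevisan–Wang 2005 Thm 5, ideal form;
this file, §1222] -/
theorem chebyshevU_span_pair_eq_span_gcd {R : Type*} [CommRing R] (m n : ℕ) :
    Ideal.span {Polynomial.Chebyshev.U R ((m : ℤ) - 1), Polynomial.Chebyshev.U R ((n : ℤ) - 1)} =
      Ideal.span {Polynomial.Chebyshev.U R ((Nat.gcd m n : ℤ) - 1)} := by
  induction m, n using Nat.gcd.induction with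
  | H0 n =>
    rw [Nat.cast_zero, zero_sub, Polynomial.Chebyshev.U_neg_one, Ideal.span_pair_comm, Ideal.span_pair_zero, Nat.gcd_zero_left]
  | H1 m n _hm ih =>
    rw [Nat.gcd_rec, ← ih, Ideal.span_pair_comm]
    conv_lhs => rw [← Nat.mod_add_div n m]
    rw [show ((((n % m + m * (n / m) : ℕ)) : ℤ)) - 1 = (((n % m : ℕ) : ℤ) - 1) + ((n / m : ℕ) : ℤ) * (m : ℤ) by push_cast; ring,
      chebyshevU_span_pair_add_mul]

/-- Shifted form: `(U_m, U_n) = (U_{gcd(m+1,n+1)−1})`. [this file, §1222] -/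
theorem chebyshevU_span_pair_eq_span_gcd_succ {R : Type*} [CommRing R] (m n : ℕ) :
    Ideal.span {Polynomial.Chebyshev.U R (m : ℤ), Polynomial.Chebyshev.U R (n : ℤ)} =
      Ideal.span {Polynomial.Chebyshev.U R ((Nat.gcd (m + 1) (n + 1) : ℤ) - 1)} := by
  have h := chebyshevU_span_pair_eq_span_gcd (R := R) (m + 1) (n + 1)
  simp only [Nat.cast_add, Nat.cast_one, add_sub_cancel_right] at h
  exact h

/-- **Bézout: `a·U_{m−1} + b·U_{n−1} = U_{gcd(m,n)−1}` for some `a, b ∈ R[X]`.** [this file, §1222] -/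
theorem chebyshevU_bezout_gcd {R : Type*} [CommRing R] (m n : ℕ) :
    ∃ a b : R[X], a * Polynomial.Chebyshev.U R ((m : ℤ) - 1) + b * Polynomial.Chebyshev.U R ((n : ℤ) - 1) = Polynomial.Chebyshev.U R ((Nat.gcd m n : ℤ) - 1) :=
  Ideal.mem_span_pair.1 (by rw [chebyshevU_span_pair_eq_span_gcd]; exact Ideal.mem_span_singleton_self _)

/-- **gcd universal property: a common divisor of `U_{m−1}` and `U_{n−1}` divides `U_{gcd(m,n)−1}`** (any commutative ring). [this file, §1222] -/
theorem dvd_chebyshevU_gcd {R : Type*} [CommRing R] {m n : ℕ} {p : R[X]}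
    (hm : p ∣ Polynomial.Chebyshev.U R ((m : ℤ) - 1)) (hn : p ∣ Polynomial.Chebyshev.U R ((n : ℤ) - 1)) :
    p ∣ Polynomial.Chebyshev.U R ((Nat.gcd m n : ℤ) - 1) := by
  obtain ⟨a, b, h⟩ := chebyshevU_bezout_gcd (R := R) m n
  rw [← h]
  exact dvd_add (dvd_mul_of_dvd_right hm a) (dvd_mul_of_dvd_right hn b)

/-- `U_{gcd(m,n)−1} ∣ U_{m−1}`. [this file, §1222] -/
theorem chebyshevU_gcd_pred_dvd_left {R : Type*} [CommRing R] (m n : ℕ) :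
    Polynomial.Chebyshev.U R ((Nat.gcd m n : ℤ) - 1) ∣ Polynomial.Chebyshev.U R ((m : ℤ) - 1) := by
  rw [← Ideal.mem_span_singleton, ← chebyshevU_span_pair_eq_span_gcd]
  exact Ideal.subset_span (Set.mem_insert _ _)

/-- `U_{gcd(m,n)−1} ∣ U_{n−1}`. [this file, §1222] -/
theorem chebyshevU_gcd_pred_dvd_right {R : Type*} [CommRing R] (m n : ℕ) :
    Polynomial.Chebyshev.U R ((Nat.gcd m n : ℤ) - 1) ∣ Polynomial.Chebyshev.U R ((n : ℤ) - 1) := by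
  rw [← Ideal.mem_span_singleton, ← chebyshevU_span_pair_eq_span_gcd]
  exact Ideal.subset_span (Set.mem_insert_of_mem _ (Set.mem_singleton _))

/-- **`gcd(m,n) = 1 ⇒ U_{m−1}, U_{n−1}` are coprime in `R[X]` for EVERY commutative ring `R`** (Bézout with `U_0 = 1`). [this file, §1222] -/
theorem chebyshevU_isCoprime_pred_of_coprime {R : Type*} [CommRing R] {m n : ℕ} (h : Nat.Coprime m n) :
    IsCoprime (Polynomial.Chebyshev.U R ((m : ℤ) - 1)) (Polynomial.Chebyshev.U R ((n : ℤ) - 1)) := by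
  obtain ⟨a, b, hab⟩ := chebyshevU_bezout_gcd (R := R) m n
  rw [Nat.Coprime.gcd_eq_one h, Nat.cast_one, sub_self, Polynomial.Chebyshev.U_zero] at hab
  exact ⟨a, b, hab⟩

/-- Shifted: `gcd(m+1, n+1) = 1 ⇒ U_m, U_n` coprime (any commutative ring). [this file, §1222] -/
theorem chebyshevU_isCoprime_of_coprime_succ {R : Type*} [CommRing R] {m n : ℕ} (h : Nat.Coprime (m + 1) (n + 1)) :
    IsCoprime (Polynomial.Chebyshev.U R (m : ℤ)) (Polynomial.Chebyshev.U R (n : ℤ)) := by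
  have h' := chebyshevU_isCoprime_pred_of_coprime (R := R) h
  simp only [Nat.cast_add, Nat.cast_one, add_sub_cancel_right] at h'
  exact h'

/-- **`IsCoprime U_{m−1} U_{n−1} ⟺ gcd(m,n) = 1` over every DOMAIN with `2 ≠ 0`** (`ℤ` included; `U_{g−1}` has degree `g − 1`). [Rayes–Trevisan–Wang 2005 Thm 5; this file, §1222] -/
theorem chebyshevU_isCoprime_pred_iff_coprime_of_isDomain {R : Type*} [CommRing R] [IsDomain R] [NeZero (2 : R)] (m n : ℕ) :
    IsCoprime (Polynomial.Chebyshev.U R ((m : ℤ) - 1)) (Polynomial.Chebyshev.U R ((n : ℤ) - 1)) ↔ Nat.Coprime m n := by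
  refine ⟨fun h => ?_, chebyshevU_isCoprime_pred_of_coprime⟩
  have hunit : IsUnit (Polynomial.Chebyshev.U R ((Nat.gcd m n : ℤ) - 1)) :=
    h.isUnit_of_dvd' (chebyshevU_gcd_pred_dvd_left m n) (chebyshevU_gcd_pred_dvd_right m n)
  obtain ⟨g, hg⟩ : ∃ g, Nat.gcd m n = g := ⟨_, rfl⟩
  rw [hg] at hunit
  rcases g with _ | k
  · rw [Nat.cast_zero, zero_sub, Polynomial.Chebyshev.U_neg_one] at hunit
    exact absurd hunit not_isUnit_zero
  · have hd := Polynomial.natDegree_eq_zero_of_isUnit hunit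
    rw [show (((k + 1 : ℕ)) : ℤ) - 1 = (k : ℤ) by push_cast; ring, Polynomial.Chebyshev.natDegree_U_natCast] at hd
    show Nat.gcd m n = 1
    rw [hg, hd]

/-- Shifted: `IsCoprime U_m U_n ⟺ gcd(m+1, n+1) = 1` over every domain with `2 ≠ 0`. [this file, §1222] -/
theorem chebyshevU_isCoprime_iff_coprime_succ_of_isDomain {R : Type*} [CommRing R] [IsDomain R] [NeZero (2 : R)] (m n : ℕ) :
    IsCoprime (Polynomial.Chebyshev.U R (m : ℤ)) (Polynomial.Chebyshev.U R (n : ℤ)) ↔ Nat.Coprime (m + 1) (n + 1) := by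
  have h := chebyshevU_isCoprime_pred_iff_coprime_of_isDomain (R := R) (m + 1) (n + 1)
  simp only [Nat.cast_add, Nat.cast_one, add_sub_cancel_right] at h
  exact h

end Summit.Ventures.HSemireg.Wedge.HankelOuter
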